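import Summits.Ventures.LatticeQCDFlow.Scaling.FlowAcceptanceCeiling

/-!
HONEST FRAMING: exact (Metropolis-corrected) sampling algorithms for lattice gauge theory; figures
of merit are autocorrelation/cost numbers at stated couplings and volumes; no continuum-physics
claim.

# CouplingOverlap — THE OVERLAP LAW: TWO MEMBERS OF A BOUNDED EXPONENTIAL FAMILY AT PARAMETERS `s < t`
# OVERLAP IN TOTAL MASS `exp(−((t−s)√M + M(t−s)²)) ≤ ∫ min(p_s, p_t) ≤ exp(−m(t−s)²/8)` (VARIANCE CEILING `M`
# / FLOOR `m`); WILSON MEASURES AT COUPLINGS `β`, `β+δ` ARE NEARLY MUTUALLY SINGULAR UNLESS `δ = O(1/√volume)`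
# — EVERY COMPACT GAUGE GROUP, EVERY COUPLING (lean-2 GEN-11, ours)

Venture-side (OURS).  Cell `lqcd-flow` (pub-lqcd), unit `pub-lqcd-lean-2-g11`, 2026-08-23.  The static
companion of the swap / IMH / reweighting laws (`SwapAcceptanceLaw`, `SwapAcceptanceLadder`,
`CouplingLadderLawAnyGroup`): the OVERLAP `∫ min(p_s, p_t) dμ` of two members of `μ_u = μ.tilted(u·X)`
(`p_u = e^{uX}/mgf(u)`, `ψ = cgf X μ`) — the total mass on which they agree, `= 1 − TV(μ_s, μ_t)`
(`overlap_eq_one_sub_half_integral_abs`); it bounds every coupling-transfer primitive (rejection, importance,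
swap, independence Metropolis).

* §1 (abstract): `integral_sqrt_tiltedDensity_mul` — the Bhattacharyya coefficient is EXACT,
  `∫ √(p_s p_t) dμ = exp(ψ((s+t)/2) − (ψ(s)+ψ(t))/2)`; `overlap_le_exp_midpoint_gap` —
  `∫ min(p_s,p_t) ≤ exp(−(ψ(s)+ψ(t)−2ψ((s+t)/2))/2)`; under a variance floor `m` on `[s,t]`:
  **`≤ exp(−m(t−s)²/8)`** (`overlap_le_exp_neg_floor`); under a ceiling `M`:
  **`≥ exp(−((t−s)√M + M(t−s)²))`** (`overlap_ge_exp_neg_ceiling`: `min(p_s,p_t) = p_s·min(1, e^{(t−s)X−(ψ(t)−ψ(s))})`,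
  Jensen under `μ_s`, `E_s|X − m_s| ≤ √Var_s`, and `|ψ(t)−ψ(s)−(t−s)m_s| ≤ M(t−s)²` by Taylor).
* §2 (Wilson, every compact `G`; `p_β = e^{−βS_W}/Z(β)` over `D[U]`): floor / ceiling forms;
  **`wilson_overlap_le_allCouplings`** (unitary `ρ`, `d ≥ 2`, `L ≥ 2`, `a ≤ b` in `[−B,B]`):
  `∫ min(p_a,p_b) dD[U] ≤ exp(−e^{−B·2NK(1+4K)}·⌊L/2⌋^d·Var_Haar(Re tr ρ)·(b−a)²/8)` — Wilson measures a fixed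
  coupling distance apart are exponentially close to mutually singular in the volume, at EVERY coupling;
  `wilson_overlap_ge_allCouplings` (`≥ exp(−((b−a)N#plaq + (N#plaq)²(b−a)²))`, trivial ceiling);
  **`wilson_overlap_le_sun`** (`SU(n)`, `0 ≤ a ≤ b`): `≤ exp(−c·#plaq·(b−a)²/(8(1+b²)))`.
Literature grade (cell rule): KNOWN MECHANISM (Bhattacharyya affinity of an exponential family
`= Z((s+t)/2)/√(Z(s)Z(t))`; Le Cam), NEW TYPING with the tree's volume-uniform variance floors, every compact
gauge group; nothing cited as a fact.  NOT CLAIMED: the sharp window between `1/volume` and `1/√volume`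
outside the strong-coupling regime; anything finite-sample; the continuum.
-/

noncomputable section

open MeasureTheory ProbabilityTheory Real Set Summit.Ventures.LatticeQCDFlow.TrivializingMaps
open Literature.MathematicalPhysics.QuantumFieldTheory Literature.MathematicalPhysics.QuantumFieldTheory.Luscher2010
open scoped Matrix Matrix.Norms.Frobenius ContDiff

namespace Summit.Ventures.LatticeQCDFlow.Scaling

/-! ## §1 Abstract overlap law for a bounded exponential family -/

section Abstract

variable {Ω : Type*} [MeasurableSpace Ω] {μ : Measure Ω} [IsProbabilityMeasure μ] {X : Ω → ℝ}

/-- `∫ p_u dμ = 1` for the tilted density `p_u = e^{uX}/mgf(u)`. [folklore] -/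
theorem integral_tiltedDensity_eq_one (hXm : Measurable X) (hXb : ∃ C, ∀ x, |X x| ≤ C) (u : ℝ) :
    ∫ x, exp (u * X x) / mgf X μ u ∂μ = 1 := by
  rw [integral_div, show (∫ x, exp (u * X x) ∂μ) = mgf X μ u from rfl,
    div_self (mgf_pos_of_bounded hXm hXb u).ne']

/-- **THE OVERLAP IS ONE MINUS THE TOTAL VARIATION**: `∫ min(p_s, p_t) dμ = 1 − ½∫|p_s − p_t| dμ`.
[folklore] -/
theorem overlap_eq_one_sub_half_integral_abs (hXm : Measurable X) (hXb : ∃ C, ∀ x, |X x| ≤ C)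
    (s t : ℝ) :
    ∫ x, min (exp (s * X x) / mgf X μ s) (exp (t * X x) / mgf X μ t) ∂μ =
      1 - (1 / 2) * ∫ x, |exp (s * X x) / mgf X μ s - exp (t * X x) / mgf X μ t| ∂μ := by
  have hps : Integrable (fun x => exp (s * X x) / mgf X μ s) μ :=
    (integrable_exp_mul_of_bounded hXm hXb s).div_const _
  have hpt : Integrable (fun x => exp (t * X x) / mgf X μ t) μ :=
    (integrable_exp_mul_of_bounded hXm hXb t).div_const _
  have hmin : ∀ x, min (exp (s * X x) / mgf X μ s) (exp (t * X x) / mgf X μ t) =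
      (1 / 2) * ((exp (s * X x) / mgf X μ s + exp (t * X x) / mgf X μ t) -
        |exp (s * X x) / mgf X μ s - exp (t * X x) / mgf X μ t|) := by
    intro x
    rcases le_total (exp (s * X x) / mgf X μ s) (exp (t * X x) / mgf X μ t) with h | h
    · rw [min_eq_left h, abs_of_nonpos (sub_nonpos.2 h)]; ring
    · rw [min_eq_right h, abs_of_nonneg (sub_nonneg.2 h)]; ring
  have h1 : Integrable (fun x => exp (s * X x) / mgf X μ s + exp (t * X x) / mgf X μ t) μ := hps.add hpt
  have h2 : Integrable (fun x => |exp (s * X x) / mgf X μ s - exp (t * X x) / mgf X μ t|) μ :=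
    (hps.sub hpt).abs
  simp_rw [hmin]
  rw [integral_const_mul, integral_sub h1 h2, integral_add hps hpt,
    integral_tiltedDensity_eq_one hXm hXb s, integral_tiltedDensity_eq_one hXm hXb t]
  ring

/-- **THE BHATTACHARYYA COEFFICIENT OF TWO FAMILY MEMBERS IS EXACT**:
`∫ √(p_s p_t) dμ = exp(ψ((s+t)/2) − (ψ(s) + ψ(t))/2)`. [folklore] -/
theorem integral_sqrt_tiltedDensity_mul (hXm : Measurable X) (hXb : ∃ C, ∀ x, |X x| ≤ C) (s t : ℝ) :
    ∫ x, sqrt (exp (s * X x) / mgf X μ s * (exp (t * X x) / mgf X μ t)) ∂μ =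
      exp (cgf X μ ((s + t) / 2) - (cgf X μ s + cgf X μ t) / 2) := by
  have hZs : 0 < mgf X μ s := mgf_pos_of_bounded hXm hXb s
  have hZt : 0 < mgf X μ t := mgf_pos_of_bounded hXm hXb t
  have h : ∀ x, sqrt (exp (s * X x) / mgf X μ s * (exp (t * X x) / mgf X μ t)) =
      exp ((s + t) / 2 * X x) * (sqrt (mgf X μ s * mgf X μ t))⁻¹ := by
    intro x
    rw [div_mul_div_comm, sqrt_div' _ (mul_pos hZs hZt).le, div_eq_mul_inv]
    congr 1
    rw [← exp_add, show s * X x + t * X x = (s + t) / 2 * X x + (s + t) / 2 * X x by ring, exp_add,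
      sqrt_mul_self (exp_pos _).le]
  simp_rw [h]
  rw [integral_mul_const, show (∫ x, exp ((s + t) / 2 * X x) ∂μ) = mgf X μ ((s + t) / 2) from rfl]
  have hZ' : ∀ u, mgf X μ u = exp (cgf X μ u) := fun u =>
    (exp_cgf (integrable_exp_mul_of_bounded hXm hXb u)).symm
  rw [hZ', hZ' s, hZ' t, ← exp_add, sqrt_eq_rpow, ← exp_mul, ← exp_neg, ← exp_add]
  congr 1
  ring

/-- **OVERLAP CEILING**: `∫ min(p_s, p_t) dμ ≤ exp(−(ψ(s) + ψ(t) − 2ψ((s+t)/2))/2)` (`min ≤ √·√` and the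
exact Bhattacharyya coefficient). [ours] -/
theorem overlap_le_exp_midpoint_gap (hXm : Measurable X) (hXb : ∃ C, ∀ x, |X x| ≤ C) (s t : ℝ) :
    ∫ x, min (exp (s * X x) / mgf X μ s) (exp (t * X x) / mgf X μ t) ∂μ ≤
      exp (-(cgf X μ s + cgf X μ t - 2 * cgf X μ ((s + t) / 2)) / 2) := by
  have hZs : 0 < mgf X μ s := mgf_pos_of_bounded hXm hXb s
  have hZt : 0 < mgf X μ t := mgf_pos_of_bounded hXm hXb t
  obtain ⟨B, hB⟩ := hXb
  have hXb : ∃ C, ∀ x, |X x| ≤ C := ⟨B, hB⟩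
  have hp0 : ∀ u x, 0 ≤ exp (u * X x) / mgf X μ u := fun u x =>
    div_nonneg (exp_pos _).le (mgf_pos_of_bounded hXm hXb u).le
  have hpb : ∀ u x, exp (u * X x) / mgf X μ u ≤ exp (|u| * B) / mgf X μ u := fun u x => by
    refine div_le_div_of_nonneg_right (exp_le_exp.2 ?_) (mgf_pos_of_bounded hXm hXb u).le
    calc u * X x ≤ |u * X x| := le_abs_self _
      _ = |u| * |X x| := abs_mul _ _
      _ ≤ |u| * B := mul_le_mul_of_nonneg_left (hB x) (abs_nonneg _)
  have hsi : Integrable (fun x => sqrt (exp (s * X x) / mgf X μ s * (exp (t * X x) / mgf X μ t))) μ := by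
    refine integrable_of_abs_le ((((measurable_const.mul hXm).exp).div_const _).mul
      (((measurable_const.mul hXm).exp).div_const _)).sqrt
      (C := sqrt (exp (|s| * B) / mgf X μ s * (exp (|t| * B) / mgf X μ t))) fun x => ?_
    rw [abs_of_nonneg (sqrt_nonneg _)]
    exact sqrt_le_sqrt (mul_le_mul (hpb s x) (hpb t x) (hp0 t x)
      (div_nonneg (exp_pos _).le hZs.le))
  calc ∫ x, min (exp (s * X x) / mgf X μ s) (exp (t * X x) / mgf X μ t) ∂μ
      ≤ ∫ x, sqrt (exp (s * X x) / mgf X μ s * (exp (t * X x) / mgf X μ t)) ∂μ := by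
        refine integral_mono_of_nonneg (ae_of_all _ fun x => le_min (hp0 s x) (hp0 t x)) hsi
          (ae_of_all _ fun x => ?_)
        have h := min_mul_le_sqrt_mul_sqrt (hp0 s x) zero_le_one (hp0 t x) zero_le_one
          (a := exp (s * X x) / mgf X μ s) (b := 1) (a' := exp (t * X x) / mgf X μ t) (b' := 1)
        simp only [mul_one] at h
        rwa [← sqrt_mul (hp0 s x)] at h
    _ = exp (cgf X μ ((s + t) / 2) - (cgf X μ s + cgf X μ t) / 2) :=
        integral_sqrt_tiltedDensity_mul hXm hXb s t
    _ = exp (-(cgf X μ s + cgf X μ t - 2 * cgf X μ ((s + t) / 2)) / 2) := by congr 1; ring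

/-- **OVERLAP UNDER A VARIANCE FLOOR: `∫ min(p_s,p_t) ≤ exp(−m(t−s)²/8)`** (`s ≤ t`, `m ≤ Var_{μ_u}(X)` on
`[s,t]`). [ours] -/
theorem overlap_le_exp_neg_floor (hXm : Measurable X) (hXb : ∃ C, ∀ x, |X x| ≤ C) {s t m : ℝ}
    (hst : s ≤ t) (hm : ∀ u ∈ Icc s t, m ≤ variance X (μ.tilted fun x => u * X x)) :
    ∫ x, min (exp (s * X x) / mgf X μ s) (exp (t * X x) / mgf X μ t) ∂μ ≤
      exp (-(m * (t - s) ^ 2 / 8)) := by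
  refine (overlap_le_exp_midpoint_gap hXm hXb s t).trans (exp_le_exp.2 ?_)
  have h := midpoint_gap_ge_of_deriv2_ge (hasDerivAt_cgf_of_bounded (μ := μ) hXm hXb)
    (hasDerivAt_deriv_cgf_of_bounded (μ := μ) hXm hXb) hst hm
  linarith

/-- **OVERLAP UNDER A VARIANCE CEILING: `∫ min(p_s,p_t) ≥ exp(−((t−s)√M + M(t−s)²))`** (`s ≤ t`,
`Var_{μ_u}(X) ≤ M` on `[s,t]`): `min(p_s,p_t) = p_s·min(1, e^{(t−s)X − (ψ(t)−ψ(s))})`, Jensen under `μ_s`,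
`E_s|X − ψ′(s)| ≤ √Var_s ≤ √M`, and `|ψ(t) − ψ(s) − (t−s)ψ′(s)| ≤ M(t−s)²` (convexity + midpoint-free Taylor
bound). [ours] -/
theorem overlap_ge_exp_neg_ceiling (hXm : Measurable X) (hXb : ∃ C, ∀ x, |X x| ≤ C) {s t M : ℝ}
    (hst : s ≤ t) (hM : ∀ u ∈ Icc s t, variance X (μ.tilted fun x => u * X x) ≤ M) :
    exp (-((t - s) * sqrt M + M * (t - s) ^ 2)) ≤
      ∫ x, min (exp (s * X x) / mgf X μ s) (exp (t * X x) / mgf X μ t) ∂μ := by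
  set νs := μ.tilted fun x => s * X x with hνs
  haveI : IsProbabilityMeasure νs := isProbabilityMeasure_tilted_mul (μ := μ) hXm hXb s
  have hM0 : 0 ≤ M := (variance_nonneg _ _).trans (hM s (left_mem_Icc.2 hst))
  have hδ : 0 ≤ t - s := sub_nonneg.2 hst
  obtain ⟨B, hB⟩ := hXb
  have hXb : ∃ C, ∀ x, |X x| ≤ C := ⟨B, hB⟩
  have hZs : 0 < mgf X μ s := mgf_pos_of_bounded hXm hXb s
  have hZt : 0 < mgf X μ t := mgf_pos_of_bounded hXm hXb t
  have hZ' : ∀ u, mgf X μ u = exp (cgf X μ u) := fun u =>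
    (exp_cgf (integrable_exp_mul_of_bounded hXm hXb u)).symm
  set Z : Ω → ℝ := fun x => (t - s) * X x - (cgf X μ t - cgf X μ s) with hZ
  have hratio : ∀ x, exp (t * X x) / mgf X μ t = exp (s * X x) / mgf X μ s * exp (Z x) := by
    intro x
    rw [hZ' t, hZ' s, ← Real.exp_sub, ← Real.exp_sub, ← Real.exp_add]
    congr 1
    simp only [hZ]
    ring
  have hstep1 : ∫ x, min (exp (s * X x) / mgf X μ s) (exp (t * X x) / mgf X μ t) ∂μ =
      ∫ x, min 1 (exp (Z x)) ∂νs := by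
    rw [hνs, integral_tilted_mul_eq_mgf]
    refine integral_congr_ae (ae_of_all _ fun x => ?_)
    simp only [smul_eq_mul]
    rw [hratio x, mul_min_of_nonneg _ _ (div_nonneg (exp_pos _).le hZs.le), mul_one]
  rw [hstep1]
  have hZm : Measurable Z := (measurable_const.mul hXm).sub measurable_const
  have hZb : ∀ x, |Z x| ≤ |t - s| * B + |cgf X μ t - cgf X μ s| := fun x => by
    rw [hZ]
    calc |(t - s) * X x - (cgf X μ t - cgf X μ s)|
        ≤ |(t - s) * X x| + |cgf X μ t - cgf X μ s| := abs_sub _ _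
      _ ≤ |t - s| * B + |cgf X μ t - cgf X μ s| := by
          rw [abs_mul]; exact add_le_add (mul_le_mul_of_nonneg_left (hB x) (abs_nonneg _)) le_rfl
  have hZi : Integrable Z νs := integrable_of_abs_le hZm hZb
  have h2a : ∫ x, exp (-|Z x|) ∂νs ≤ ∫ x, min 1 (exp (Z x)) ∂νs := by
    refine integral_mono_of_nonneg (ae_of_all _ fun x => (exp_pos _).le)
      (integrable_of_abs_le (measurable_const.min hZm.exp) (C := 1) fun x => ?_)
      (ae_of_all _ fun x => exp_neg_abs_le_min_one_exp (Z x))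
    rw [abs_of_nonneg (le_min zero_le_one (exp_pos _).le)]
    exact min_le_left _ _
  have h2b : exp (∫ x, -|Z x| ∂νs) ≤ ∫ x, exp (-|Z x|) ∂νs := by
    have hgi : Integrable (exp ∘ fun x => -|Z x|) νs := by
      refine integrable_of_abs_le (hZm.abs.neg.exp) (C := 1) fun x => ?_
      simp only [Function.comp_apply]
      rw [abs_of_pos (exp_pos _), ← exp_zero]
      exact exp_le_exp.2 (neg_nonpos.2 (abs_nonneg _))
    exact ConvexOn.map_integral_le convexOn_exp continuousOn_exp isClosed_univ
      (ae_of_all _ fun x => mem_univ _) hZi.abs.neg hgi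
  have hmean : ∫ x, X x ∂νs = deriv (cgf X μ) s := integral_tilted_eq_deriv_cgf hXm hXb s
  have hψ' := hasDerivAt_cgf_of_bounded (μ := μ) hXm hXb
  have hψ'' := hasDerivAt_deriv_cgf_of_bounded (μ := μ) hXm hXb
  have htaylor : |cgf X μ t - cgf X μ s - (t - s) * deriv (cgf X μ) s| ≤ M * (t - s) ^ 2 := by
    rcases eq_or_lt_of_le hst with h | h
    · subst h; simp
    · -- `ψ(t) − ψ(s) = ψ′(ξ)(t−s)`, `ψ′(ξ) − ψ′(s) = ψ″(η)(ξ−s)`, `0 ≤ ψ″ ≤ M`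
      obtain ⟨ξ, hξ, hslope⟩ := exists_hasDerivAt_eq_slope (cgf X μ) (deriv (cgf X μ)) h
        (fun u _ => (hψ' u).continuousAt.continuousWithinAt) (fun u _ => hψ' u)
      have heq : cgf X μ t - cgf X μ s = deriv (cgf X μ) ξ * (t - s) := by
        rw [hslope, div_mul_cancel₀ _ (sub_ne_zero.2 (ne_of_gt h))]
      have hξs : s < ξ := hξ.1
      obtain ⟨η, hη, hslope2⟩ := exists_hasDerivAt_eq_slope (deriv (cgf X μ))
        (fun u => variance X (μ.tilted fun x => u * X x)) hξs
        (fun u _ => (hψ'' u).continuousAt.continuousWithinAt) (fun u _ => hψ'' u)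
      have heq2 : deriv (cgf X μ) ξ - deriv (cgf X μ) s =
          variance X (μ.tilted fun x => η * X x) * (ξ - s) := by
        rw [hslope2, div_mul_cancel₀ _ (sub_ne_zero.2 (ne_of_gt hξs))]
      have hη' : η ∈ Icc s t := ⟨hη.1.le, (hη.2.trans hξ.2).le⟩
      have hv0 : 0 ≤ variance X (μ.tilted fun x => η * X x) := variance_nonneg _ _
      have hvM := hM η hη'
      have hξt : ξ - s ≤ t - s := by linarith [hξ.2]
      have hξ0 : 0 ≤ ξ - s := by linarith
      rw [heq, show deriv (cgf X μ) ξ * (t - s) - (t - s) * deriv (cgf X μ) s =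
        (deriv (cgf X μ) ξ - deriv (cgf X μ) s) * (t - s) by ring, heq2,
        abs_of_nonneg (by positivity)]
      calc variance X (μ.tilted fun x => η * X x) * (ξ - s) * (t - s)
          ≤ M * (t - s) * (t - s) := by gcongr
        _ = M * (t - s) ^ 2 := by ring
  have hXi : Integrable X νs := integrable_of_abs_le hXm hB
  have hdev : ∫ x, |X x - deriv (cgf X μ) s| ∂νs ≤ sqrt M := by
    have hmem : MemLp (fun x => |X x - deriv (cgf X μ) s|) 2 νs :=
      memLp_of_bounded (a := -(B + abs (deriv (cgf X μ) s))) (b := B + abs (deriv (cgf X μ) s))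
        (ae_of_all _ fun x => by
          have h1 : 0 ≤ abs (X x - deriv (cgf X μ) s) := abs_nonneg _
          have h2 : 0 ≤ abs (deriv (cgf X μ) s) := abs_nonneg _
          have h3 : 0 ≤ B := (abs_nonneg _).trans (hB x)
          have h4 : abs (X x - deriv (cgf X μ) s) ≤ B + abs (deriv (cgf X μ) s) :=
            (abs_sub _ _).trans (add_le_add (hB x) le_rfl)
          simp only [Pi.sub_apply, Set.mem_Icc]
          exact ⟨by linarith, h4⟩)
        (hXm.sub measurable_const).abs.aestronglyMeasurable 2
    have hv := variance_nonneg (fun x => |X x - deriv (cgf X μ) s|) νs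
    rw [variance_eq_sub hmem] at hv
    have hsq : ∫ x, ((fun x => |X x - deriv (cgf X μ) s|) ^ 2) x ∂νs =
        variance X νs := by
      rw [variance_eq_integral hXm.aemeasurable, hmean]
      exact integral_congr_ae (ae_of_all _ fun x => by simp [sq_abs])
    rw [hsq] at hv
    have hnn : 0 ≤ ∫ x, |X x - deriv (cgf X μ) s| ∂νs := integral_nonneg fun x => abs_nonneg _
    refine (Real.le_sqrt hnn hM0).2 ?_
    have hVs := hM s (left_mem_Icc.2 hst)
    rw [← hνs] at hVs
    linarith
  have hEZ : ∫ x, |Z x| ∂νs ≤ (t - s) * sqrt M + M * (t - s) ^ 2 := by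
    have hpt : ∀ x, |Z x| ≤ (t - s) * |X x - deriv (cgf X μ) s| +
        |cgf X μ t - cgf X μ s - (t - s) * deriv (cgf X μ) s| := by
      intro x
      show |(t - s) * X x - (cgf X μ t - cgf X μ s)| ≤ _
      have : (t - s) * X x - (cgf X μ t - cgf X μ s) =
          (t - s) * (X x - deriv (cgf X μ) s) - (cgf X μ t - cgf X μ s - (t - s) * deriv (cgf X μ) s) := by
        ring
      rw [this]
      refine (abs_sub _ _).trans ?_
      rw [abs_mul, abs_of_nonneg hδ]
    have hI0 : Integrable (fun x => |X x - deriv (cgf X μ) s|) νs := (hXi.sub (integrable_const _)).abs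
    have hI1 : Integrable (fun x => (t - s) * |X x - deriv (cgf X μ) s|) νs := hI0.const_mul _
    have hI2 : Integrable (fun _ : Ω => |cgf X μ t - cgf X μ s - (t - s) * deriv (cgf X μ) s|) νs :=
      integrable_const _
    have hIZ : Integrable (fun x => |Z x|) νs := hZi.abs
    calc ∫ x, |Z x| ∂νs
        ≤ ∫ x, ((t - s) * |X x - deriv (cgf X μ) s| +
            |cgf X μ t - cgf X μ s - (t - s) * deriv (cgf X μ) s|) ∂νs :=
          integral_mono hIZ (hI1.add hI2) hpt
      _ = (t - s) * ∫ x, |X x - deriv (cgf X μ) s| ∂νs +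
            |cgf X μ t - cgf X μ s - (t - s) * deriv (cgf X μ) s| := by
          rw [integral_add hI1 hI2, integral_const_mul, integral_const, smul_eq_mul, probReal_univ,
            one_mul]
      _ ≤ (t - s) * sqrt M + M * (t - s) ^ 2 :=
          add_le_add (mul_le_mul_of_nonneg_left hdev hδ) htaylor
  calc exp (-((t - s) * sqrt M + M * (t - s) ^ 2)) ≤ exp (∫ x, -|Z x| ∂νs) := by
        rw [integral_neg]; exact exp_le_exp.2 (neg_le_neg hEZ)
    _ ≤ ∫ x, exp (-|Z x|) ∂νs := h2b
    _ ≤ ∫ x, min 1 (exp (Z x)) ∂νs := h2a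

end Abstract

/-! ## §2 The Wilson coupling family, every compact gauge group -/

section Wilson

variable {d L N : ℕ} [NeZero L] {G : Type*} [Group G] [TopologicalSpace G] [IsTopologicalGroup G]
  [CompactSpace G] [MeasurableSpace G] [BorelSpace G] [SecondCountableTopology G]
  (ρ : G →* Matrix (Fin N) (Fin N) ℂ)

/-- **OVERLAP OF TWO WILSON MEASURES UNDER A SPECIFIC-HEAT FLOOR** (`a ≤ b`, `m ≤ Var_u(S_W)` on `[a,b]`):
`∫ min(p_a, p_b) dD[U] ≤ exp(−m(b−a)²/8)`, `p_β = e^{−βS_W}/Z(β)`. [ours] -/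
theorem wilson_overlap_le_of_floor (hρ : Continuous ρ) {a b m : ℝ} (hab : a ≤ b)
    (hm : ∀ u ∈ Icc a b, m ≤ variance (wilsonAction (d := d) (L := L) ρ) (wilsonMeasure (d := d) (L := L) ρ u)) :
    ∫ U, min (exp (a * (-wilsonAction ρ U)) / mgf (fun U => -wilsonAction ρ U) (trivialMeasure G d L) a)
        (exp (b * (-wilsonAction ρ U)) / mgf (fun U => -wilsonAction ρ U) (trivialMeasure G d L) b)
        ∂(trivialMeasure G d L) ≤ exp (-(m * (b - a) ^ 2 / 8)) := by
  haveI : IsProbabilityMeasure (trivialMeasure G d L) := trivialMeasure_isProbabilityMeasure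
  refine overlap_le_exp_neg_floor (μ := trivialMeasure G d L) (measurable_neg_wilsonAction ρ hρ)
    (neg_wilsonAction_bounded ρ hρ) hab fun u hu => ?_
  have h := hm u hu
  rwa [← tilted_neg_wilsonAction_eq ρ hρ u, ← variance_fun_neg] at h

/-- **OVERLAP OF TWO WILSON MEASURES UNDER A SPECIFIC-HEAT CEILING** (`a ≤ b`, `Var_u(S_W) ≤ M` on `[a,b]`):
`∫ min(p_a, p_b) dD[U] ≥ exp(−((b−a)√M + M(b−a)²))`. [ours] -/
theorem wilson_overlap_ge_of_ceiling (hρ : Continuous ρ) {a b M : ℝ} (hab : a ≤ b)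
    (hM : ∀ u ∈ Icc a b, variance (wilsonAction (d := d) (L := L) ρ) (wilsonMeasure (d := d) (L := L) ρ u) ≤ M) :
    exp (-((b - a) * sqrt M + M * (b - a) ^ 2)) ≤
      ∫ U, min (exp (a * (-wilsonAction ρ U)) / mgf (fun U => -wilsonAction ρ U) (trivialMeasure G d L) a)
        (exp (b * (-wilsonAction ρ U)) / mgf (fun U => -wilsonAction ρ U) (trivialMeasure G d L) b)
        ∂(trivialMeasure G d L) := by
  haveI : IsProbabilityMeasure (trivialMeasure G d L) := trivialMeasure_isProbabilityMeasure
  refine overlap_ge_exp_neg_ceiling (μ := trivialMeasure G d L) (measurable_neg_wilsonAction ρ hρ)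
    (neg_wilsonAction_bounded ρ hρ) hab fun u hu => ?_
  have h := hM u hu
  rwa [← tilted_neg_wilsonAction_eq ρ hρ u, ← variance_fun_neg] at h

/-- **WILSON MEASURES A FIXED COUPLING DISTANCE APART ARE EXPONENTIALLY CLOSE TO MUTUALLY SINGULAR IN THE
VOLUME, AT EVERY COUPLING, FOR EVERY COMPACT GAUGE GROUP** (unitary `ρ`, `d ≥ 2`, `L ≥ 2`, `−B ≤ a ≤ b ≤ B`):
`∫ min(p_a, p_b) dD[U] ≤ exp(−e^{−B·2NK(1+4K)}·⌊L/2⌋^d·Var_Haar(Re tr ρ)·(b−a)²/8)`. [ours] -/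
theorem wilson_overlap_le_allCouplings (hd : 2 ≤ d) (hL : 2 ≤ L) (hρ : Continuous ρ)
    (hρu : ∀ g, ρ g ∈ Matrix.unitaryGroup (Fin N) ℂ) {a b B : ℝ} (ha : -B ≤ a) (hab : a ≤ b)
    (hb : b ≤ B) :
    ∫ U, min (exp (a * (-wilsonAction ρ U)) / mgf (fun U => -wilsonAction ρ U) (trivialMeasure G d L) a)
        (exp (b * (-wilsonAction ρ U)) / mgf (fun U => -wilsonAction ρ U) (trivialMeasure G d L) b)
        ∂(trivialMeasure G d L) ≤
      exp (-(Real.exp (-(B * (2 * N * ((d + 1) * d ^ 2 : ℕ) * (1 + 4 * ((d + 1) * d ^ 2 : ℕ))))) *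
        ((L / 2) ^ d : ℕ) * variance (fun g => (ρ g).trace.re) (haarProbability G) * (b - a) ^ 2 / 8)) := by
  refine wilson_overlap_le_of_floor (d := d) (L := L) ρ hρ hab fun u hu => ?_
  refine le_trans ?_ (wilson_variance_ge_allCouplings (d := d) (L := L) ρ hd hL hρ hρu u)
  have hv : 0 ≤ variance (fun g => (ρ g).trace.re) (haarProbability G) := variance_nonneg _ _
  have hu' : |u| ≤ B := abs_le.2 ⟨by linarith [hu.1], by linarith [hu.2]⟩
  have hc : 0 ≤ (2 * N * ((d + 1) * d ^ 2 : ℕ) * (1 + 4 * ((d + 1) * d ^ 2 : ℕ)) : ℝ) := by positivity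
  gcongr

/-- **The overlap is never smaller than `exp(−((b−a)N#plaq + (N#plaq)²(b−a)²))`** (trivial ceiling
`Var ≤ (N#plaq)²`), every coupling, every compact `G`, every `L`. [ours] -/
theorem wilson_overlap_ge_allCouplings (hρ : Continuous ρ) {a b : ℝ} (hab : a ≤ b) :
    exp (-((b - a) * ((N : ℝ) * Fintype.card (Plaquette d L)) +
        ((N : ℝ) * Fintype.card (Plaquette d L)) ^ 2 * (b - a) ^ 2)) ≤
      ∫ U, min (exp (a * (-wilsonAction ρ U)) / mgf (fun U => -wilsonAction ρ U) (trivialMeasure G d L) a)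
        (exp (b * (-wilsonAction ρ U)) / mgf (fun U => -wilsonAction ρ U) (trivialMeasure G d L) b)
        ∂(trivialMeasure G d L) := by
  have hP : 0 ≤ (N : ℝ) * Fintype.card (Plaquette d L) := by positivity
  have h := wilson_overlap_ge_of_ceiling (d := d) (L := L) ρ hρ hab fun u _ => wilson_variance_le_sq ρ hρ u
  rwa [sqrt_sq hP] at h

end Wilson

/-! ## §3 `SU(n)`: polynomial constants at every coupling -/

section SUN

variable {d n : ℕ}

/-- **`SU(n)`, `n ≥ 2`, `d ≥ 2`**: one `c = c(n,d) > 0` with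
`∫ min(p_a, p_b) dD[U] ≤ exp(−c·#plaq·(b−a)²/(8(1+b²)))` for every `L ≥ 2` and all `0 ≤ a ≤ b` (item 129's
all-coupling floor). [ours] -/
theorem wilson_overlap_le_sun (hn : 2 ≤ n) (hd : 2 ≤ d) :
    ∃ c : ℝ, 0 < c ∧ ∀ (L : ℕ) [NeZero L], 2 ≤ L → ∀ a b : ℝ, 0 ≤ a → a ≤ b →
      ∫ U, min (exp (a * (-wilsonAction (StrongCoupling.defRep n) U)) /
            mgf (fun U => -wilsonAction (StrongCoupling.defRep n) U)
              (trivialMeasure (Matrix.specialUnitaryGroup (Fin n) ℂ) d L) a)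
          (exp (b * (-wilsonAction (StrongCoupling.defRep n) U)) /
            mgf (fun U => -wilsonAction (StrongCoupling.defRep n) U)
              (trivialMeasure (Matrix.specialUnitaryGroup (Fin n) ℂ) d L) b)
          ∂(trivialMeasure (Matrix.specialUnitaryGroup (Fin n) ℂ) d L) ≤
        exp (-(c * Fintype.card (Plaquette d L) * (b - a) ^ 2 / (8 * (1 + b ^ 2)))) := by
  obtain ⟨c, hc, h⟩ := wilson_variance_floor_allCouplings_rep (d := d) (n := n) hn hd
  refine ⟨c, hc, fun L _ hL a b ha hab => ?_⟩
  have hρ : Continuous (StrongCoupling.defRep n) := continuous_subtype_val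
  have h1 := wilson_overlap_le_of_floor (d := d) (L := L) (StrongCoupling.defRep n) hρ hab
    (m := c * Fintype.card (Plaquette d L) / (1 + b ^ 2)) (fun u hu => ?_)
  · have hexp : c * Fintype.card (Plaquette d L) / (1 + b ^ 2) * (b - a) ^ 2 / 8 =
        c * Fintype.card (Plaquette d L) * (b - a) ^ 2 / (8 * (1 + b ^ 2)) := by
      rw [div_mul_eq_mul_div, div_div, mul_comm (1 + b ^ 2) 8]
    rw [hexp] at h1
    exact h1
  · have hu0 : 0 ≤ u := ha.trans hu.1
    refine le_trans ?_ (h L hL u hu0)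
    have hP : 0 ≤ c * Fintype.card (Plaquette d L) := by positivity
    have hu1 : 1 + u ^ 2 ≤ 1 + b ^ 2 := by nlinarith [hu.1, hu.2]
    exact div_le_div_of_nonneg_left hP (by positivity) hu1

end SUN

end Summit.Ventures.LatticeQCDFlow.Scaling

end
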